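import Summits.Schanuel.Schanuel.Theorems.SoloInformedRoyNoExactWitness
import Literature.NumberTheory.Transcendental.BakerQuantArith
import Literature.Barriers.Schanuel.NesterenkoModularScopeOperatorProofs

/-!
# Liouville's inequality for the values `(D^k Q)(my, α^m)` at algebraic points

Arithmetic input for `SoloInformedRoyLiouvillePoints`: if `y₀, α₀` lie in a number field `K`
(embedded by `σ : K → ℂ`), `Q ∈ ℤ[X₀, X₁]` has bidegree `≤ (T₀, T₁)` and
`x = (D^k Q)(m σy₀, σα₀^m) ≠ 0`, then
`|x| ≥ exp(-[K:ℚ] (A₁ + A₂))` with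
`A₁ = T₀ log b_y + T₁ m log b_α` (denominators `b_y y₀, b_α α₀ ∈ 𝓞_K`) and
`A₂ = k log k + T₀ + T₁ + log⁺ H(Q) + T₀ log(m C_y + 1) + T₁ (m log C_α + 1)` (`C_y, C_α` bounds
for the houses of `y₀, α₀`): `royD_value_liouville`. Ingredients: `D = ∂₀ + X₁∂₁` does not raise
partial degrees (`degreeOf_iterate_royD_le`, from the Euler-operator lemmas of
`Literature.Barriers.Schanuel`), integrality of `b_y^{T₀} b_α^{mT₁} · P(my₀, α₀^m)`
(`isIntegral_natCast_mul_aeval`), Cauchy's inequality for `s ↦ Q(z + s, w e^s)` on `|s| = 1`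
(`norm_aeval_iterate_royD_le`, via the tree's `iteratedDeriv_aeval_add_mul_exp`), and the
Liouville (norm) inequality `Baker1975.Ch3.liouville_lower_bound` of the tree.

References: A. Baker, *Transcendental number theory* (1975), Ch. 3 §3 (Liouville estimate)
[BakerTNT1975]; D. Roy, Acta Arith. 97 (2001), Thm. 1 [Roy2001].
-/

noncomputable section

open MvPolynomial Filter Complex
open Literature.NumberTheory.Transcendental
open Literature.NumberTheory.Transcendental.Baker1975.Ch3 (liouville_lower_bound)
open Literature.Barriers.Schanuel (degreeOf_pderiv_le degreeOf_X_mul_pderiv_le)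

namespace Summit.Schanuel.Schanuel.Theorems

/-! ### `D` does not raise partial degrees -/

/-- `deg_{X_i} (D P) ≤ deg_{X_i} P` for `D = ∂₀ + X₁∂₁`. [cite: Roy2001, §1 (the derivation D)] -/
theorem degreeOf_royD_le (P : MvPolynomial (Fin 2) ℤ) (i : Fin 2) :
    (royD P).degreeOf i ≤ P.degreeOf i := by
  classical
  rw [royD]
  refine (degreeOf_add_le _ _ _).trans (max_le (degreeOf_pderiv_le 0 i P) ?_)
  fin_cases i
  · refine (degreeOf_mul_le _ _ _).trans ?_
    rw [degreeOf_X]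
    simpa using degreeOf_pderiv_le 1 0 P
  · simpa using degreeOf_X_mul_pderiv_le 1 P

/-- `deg_{X_i} (D^k P) ≤ deg_{X_i} P`. [cite: Roy2001, §1 (the derivation D)] -/
theorem degreeOf_iterate_royD_le (P : MvPolynomial (Fin 2) ℤ) (i : Fin 2) (k : ℕ) :
    (royD^[k] P).degreeOf i ≤ P.degreeOf i := by
  induction k with
  | zero => simp
  | succ k ih =>
    rw [Function.iterate_succ_apply']
    exact (degreeOf_royD_le _ i).trans ih

/-! ### Values, conjugates and denominators -/

/-- Value of a monomial at `(z, w)`. [folklore] -/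
theorem aeval_monomial_pair {R : Type*} [CommRing R] (z w : R) (s : Fin 2 →₀ ℕ) (c : ℤ) :
    aeval ![z, w] (monomial s c) = (c : R) * (z ^ s 0 * w ^ s 1) := by
  rw [aeval_monomial, Finsupp.prod_fintype _ _ (fun i => pow_zero _), Fin.prod_univ_two,
    algebraMap_int_eq, eq_intCast]
  simp

/-- **Denominators**: if `b_z z` and `b_w w` are integral and `P ∈ ℤ[X₀, X₁]` has bidegree
`≤ (A, B)`, then `b_z^A b_w^B · P(z, w)` is integral. [folklore] -/
theorem isIntegral_natCast_mul_aeval {R : Type*} [CommRing R] (P : MvPolynomial (Fin 2) ℤ)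
    {A B : ℕ} (hA : P.degreeOf 0 ≤ A) (hB : P.degreeOf 1 ≤ B) {z w : R} {bz bw : ℕ}
    (hz : IsIntegral ℤ ((bz : R) * z)) (hw : IsIntegral ℤ ((bw : R) * w)) :
    IsIntegral ℤ (((bz ^ A * bw ^ B : ℕ) : R) * aeval ![z, w] P) := by
  rw [P.as_sum, map_sum, Finset.mul_sum]
  refine IsIntegral.sum _ fun s hs => ?_
  have h0 : s 0 ≤ A := (monomial_le_degreeOf 0 hs).trans hA
  have h1 : s 1 ≤ B := (monomial_le_degreeOf 1 hs).trans hB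
  have e : ((bz ^ A * bw ^ B : ℕ) : R) * aeval ![z, w] (monomial s (P.coeff s)) =
      ((P.coeff s : ℤ) : R) * ((bz : R) ^ (A - s 0) * (bw : R) ^ (B - s 1)) *
        (((bz : R) * z) ^ s 0 * ((bw : R) * w) ^ s 1) := by
    rw [aeval_monomial_pair]
    have ez : (bz : R) ^ A = (bz : R) ^ (A - s 0) * (bz : R) ^ s 0 := by
      rw [← pow_add, Nat.sub_add_cancel h0]
    have ew : (bw : R) ^ B = (bw : R) ^ (B - s 1) * (bw : R) ^ s 1 := by
      rw [← pow_add, Nat.sub_add_cancel h1]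
    push_cast
    rw [ez, ew, mul_pow, mul_pow]
    ring
  rw [e]
  exact ((isIntegral_intCast _).mul (((isIntegral_natCast _).pow _).mul
    ((isIntegral_natCast _).pow _))).mul ((hz.pow _).mul (hw.pow _))

/-- Conjugation commutes with evaluation of integer polynomials. [folklore] -/
theorem ringHom_aeval_pair {R S : Type*} [CommRing R] [CommRing S] (φ : R →+* S) (z w : R)
    (P : MvPolynomial (Fin 2) ℤ) : φ (aeval ![z, w] P) = aeval ![φ z, φ w] P := by
  have hv : (φ : R → S) ∘ ![z, w] = ![φ z, φ w] := by
    funext i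
    refine Fin.cases ?_ (fun i => ?_) i <;> simp
  rw [aeval_def, eval₂_comp_left, hv, aeval_def,
    RingHom.ext_int (φ.comp (algebraMap ℤ R)) (algebraMap ℤ S)]

/-- Every element of a number field has a positive integer denominator. [folklore] -/
theorem royLiou_exists_den {K : Type*} [Field K] [NumberField K] (x : K) :
    ∃ b : ℕ, 1 ≤ b ∧ IsIntegral ℤ ((b : K) * x) := by
  obtain ⟨y, hy0, hint⟩ := ((IsFractionRing.isAlgebraic_iff ℤ ℚ K).mpr
    (Algebra.IsAlgebraic.isAlgebraic (R := ℚ) x)).exists_integral_multiple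
  refine ⟨y.natAbs, Int.natAbs_pos.mpr hy0, ?_⟩
  have hcast : ((y.natAbs : ℕ) : K) = ((y.natAbs : ℤ) : K) := (Int.cast_natCast _).symm
  rcases Int.natAbs_eq y with h | h
  · rw [hcast, ← h, ← zsmul_eq_mul]; exact hint
  · rw [hcast, show (y.natAbs : ℤ) = -y by omega, Int.cast_neg, neg_mul, ← zsmul_eq_mul]
    exact hint.neg

/-! ### Cauchy's inequality for `(D^k Q)(z, w)` at an arbitrary point -/

/-- `|(D^k Q)(z, w)| ≤ k! (T₀+1)(T₁+1) H(Q) (|z|+1)^{T₀} max(1, e|w|)^{T₁}`: Cauchy's inequality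
for `s ↦ Q(z + s, w e^s)` on `|s| = 1`, whose `k`-th derivative at `0` is `(D^k Q)(z, w)`.
(Variant of `norm_aeval_iterate_royD_le_of_degreeOf_le` (file `SoloInformedRoyBandProduct`)
with the factor `max(1, e|w|)` in place of `e(1+|w|)`, which is what the Liouville count needs at
`w = α^m`.) [cite: Roy2001, §5 (p. 194, Cauchy's inequalities)] -/
theorem norm_aeval_iterate_royD_le (k : ℕ) (Q : MvPolynomial (Fin 2) ℤ) {T₀ T₁ : ℕ}
    (h0 : Q.degreeOf 0 ≤ T₀) (h1 : Q.degreeOf 1 ≤ T₁) (z w : ℂ) :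
    ‖aeval ![z, w] (royD^[k] Q)‖ ≤ k.factorial * ((((T₀ + 1) * (T₁ + 1) : ℕ) : ℝ) *
      mvPolyHeight Q * (‖z‖ + 1) ^ T₀ * (max 1 (‖w‖ * Real.exp 1)) ^ T₁) := by
  set C : ℝ := (((T₀ + 1) * (T₁ + 1) : ℕ) : ℝ) * mvPolyHeight Q * (‖z‖ + 1) ^ T₀ *
    (max 1 (‖w‖ * Real.exp 1)) ^ T₁ with hC
  have hdiff : Differentiable ℂ fun s : ℂ => aeval ![z + s, w * cexp s] Q :=
    fun t => (hasDerivAt_aeval_add_mul_exp Q z w t).differentiableAt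
  have hbd : ∀ s ∈ Metric.sphere (0 : ℂ) 1, ‖aeval ![z + s, w * cexp s] Q‖ ≤ C := by
    intro s hs
    have hs1 : ‖s‖ = 1 := by simpa using hs
    refine norm_aeval_le_of_degreeOf_le Q h0 h1 (z + s) (w * cexp s) ?_ ?_ ?_ (le_max_left _ _)
    · exact (norm_add_le _ _).trans (by rw [hs1])
    · rw [norm_mul, Complex.norm_exp]
      refine le_trans ?_ (le_max_right _ _)
      gcongr
      exact (le_abs_self _).trans ((Complex.abs_re_le_norm s).trans_eq hs1)
    · linarith [norm_nonneg z]
  have h := Complex.norm_iteratedDeriv_le_of_forall_mem_sphere_norm_le k one_pos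
    hdiff.diffContOnCl hbd
  rw [iteratedDeriv_aeval_add_mul_exp] at h
  simpa using h

/-! ### The Liouville estimate for `(D^k Q)(my, α^m)` -/

/-- **Liouville's inequality for `x = (D^k Q)(m σy₀, σα₀^m) ≠ 0`** at a point of a number field
`K`: `|x| ≥ exp(-[K:ℚ](A₁ + A₂))` with `A₁ = T₀ log b_y + T₁ m log b_α` (denominators) and
`A₂ = k log k + T₀ + T₁ + log max(1, H(Q)) + T₀ log(m C_y + 1) + T₁ (m log C_α + 1)`
(a bound for the logarithms of all conjugates of `x`).
[cite: BakerTNT1975, Ch. 3 §3 (Liouville estimate); Roy2001, Thm. 1] -/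
theorem royD_value_liouville {K : Type*} [Field K] [NumberField K] (σ : K →+* ℂ) (y₀ α₀ : K)
    {by_ bα : ℕ} (hby : 1 ≤ by_) (hbα : 1 ≤ bα) (hyint : IsIntegral ℤ ((by_ : K) * y₀))
    (hαint : IsIntegral ℤ ((bα : K) * α₀)) {Cy Cα : ℝ} (hCy : ∀ φ : K →+* ℂ, ‖φ y₀‖ ≤ Cy)
    (hCα : ∀ φ : K →+* ℂ, ‖φ α₀‖ ≤ Cα) (hCy0 : 0 ≤ Cy) (hCα1 : 1 ≤ Cα)
    (Q : MvPolynomial (Fin 2) ℤ) {T₀ T₁ : ℕ} (h0 : Q.degreeOf 0 ≤ T₀) (h1 : Q.degreeOf 1 ≤ T₁)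
    (k m : ℕ) (hx : aeval ![(m : ℂ) * σ y₀, σ α₀ ^ m] (royD^[k] Q) ≠ 0) :
    Real.exp (-((Module.finrank ℚ K : ℝ) *
        ((T₀ * Real.log by_ + T₁ * (m * Real.log bα)) +
          (k * Real.log k + (T₀ + T₁) + Real.log (max 1 (mvPolyHeight Q : ℝ)) +
            T₀ * Real.log (m * Cy + 1) + T₁ * (m * Real.log Cα + 1))))) ≤
      ‖aeval ![(m : ℂ) * σ y₀, σ α₀ ^ m] (royD^[k] Q)‖ := by
  classical
  set P := royD^[k] Q with hP
  set ξ : K := aeval ![(m : K) * y₀, α₀ ^ m] P with hξ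
  set d : ℕ := Module.finrank ℚ K with hd
  set A₁ : ℝ := T₀ * Real.log by_ + T₁ * (m * Real.log bα) with hA₁
  set A₂ : ℝ := k * Real.log k + (T₀ + T₁) + Real.log (max 1 (mvPolyHeight Q : ℝ)) +
    T₀ * Real.log (m * Cy + 1) + T₁ * (m * Real.log Cα + 1) with hA₂
  have hP0 : P.degreeOf 0 ≤ T₀ := (degreeOf_iterate_royD_le Q 0 k).trans h0
  have hP1 : P.degreeOf 1 ≤ T₁ := (degreeOf_iterate_royD_le Q 1 k).trans h1
  have hconj : ∀ φ : K →+* ℂ, φ ξ = aeval ![(m : ℂ) * φ y₀, φ α₀ ^ m] P := by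
    intro φ; rw [hξ, ringHom_aeval_pair, map_mul, map_natCast, map_pow]
  have hξ0 : ξ ≠ 0 := fun h => hx (by rw [← hconj σ, h, map_zero])
  -- denominator
  have hint : IsIntegral ℤ (((by_ ^ T₀ * (bα ^ m) ^ T₁ : ℕ) : K) * ξ) := by
    have hw : IsIntegral ℤ (((bα ^ m : ℕ) : K) * α₀ ^ m) := by
      rw [Nat.cast_pow, ← mul_pow]; exact hαint.pow _
    have hz : IsIntegral ℤ ((by_ : K) * ((m : K) * y₀)) := by
      rw [mul_left_comm]; exact (isIntegral_natCast _).mul hyint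
    exact isIntegral_natCast_mul_aeval P hP0 hP1 hz hw
  have hb1 : 1 ≤ by_ ^ T₀ * (bα ^ m) ^ T₁ :=
    Nat.one_le_iff_ne_zero.mpr (by positivity)
  -- nonnegativity of the exponents
  have hklog : (0 : ℝ) ≤ k * Real.log k := by
    rcases Nat.eq_zero_or_pos k with rfl | hk
    · simp
    · exact mul_nonneg (Nat.cast_nonneg _) (Real.log_nonneg (by exact_mod_cast hk))
  have hlogH : 0 ≤ Real.log (max 1 (mvPolyHeight Q : ℝ)) := Real.log_nonneg (le_max_left _ _)
  have hlogm : 0 ≤ Real.log (m * Cy + 1) :=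
    Real.log_nonneg (le_add_of_nonneg_left (by positivity))
  have hlogCα : 0 ≤ Real.log Cα := Real.log_nonneg hCα1
  have hT₀m : (0 : ℝ) ≤ T₀ * Real.log (m * Cy + 1) := by positivity
  have hT₁m : (0 : ℝ) ≤ T₁ * (m * Real.log Cα + 1) := by positivity
  have hA₂0 : 0 ≤ A₂ := by rw [hA₂]; positivity
  have hA₁0 : 0 ≤ A₁ := by
    have := Real.log_nonneg (show (1 : ℝ) ≤ by_ by exact_mod_cast hby)
    have := Real.log_nonneg (show (1 : ℝ) ≤ bα by exact_mod_cast hbα)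
    rw [hA₁]; positivity
  -- all conjugates are `≤ exp A₂`
  have hMb : ∀ φ : K →+* ℂ, ‖φ ξ‖ ≤ Real.exp A₂ := by
    intro φ
    rw [hconj φ]
    refine (norm_aeval_iterate_royD_le k Q h0 h1 _ _).trans ?_
    have f1 : (k.factorial : ℝ) ≤ Real.exp (k * Real.log k) := by
      rcases Nat.eq_zero_or_pos k with rfl | hk
      · simp
      · have h1 : (k.factorial : ℝ) ≤ (k : ℝ) ^ k := by exact_mod_cast Nat.factorial_le_pow k
        rw [Real.exp_nat_mul, Real.exp_log (by exact_mod_cast hk)]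
        exact h1
    have f2 : ((((T₀ + 1) * (T₁ + 1) : ℕ) : ℝ)) ≤ Real.exp ((T₀ : ℝ) + T₁) := by
      push_cast
      rw [Real.exp_add]
      exact mul_le_mul (Real.add_one_le_exp _) (Real.add_one_le_exp _) (by positivity)
        (by positivity)
    have f3 : (mvPolyHeight Q : ℝ) ≤ Real.exp (Real.log (max 1 (mvPolyHeight Q : ℝ))) := by
      rw [Real.exp_log (by positivity)]; exact le_max_right _ _
    have f4 : (‖(m : ℂ) * φ y₀‖ + 1) ^ T₀ ≤ Real.exp (T₀ * Real.log (m * Cy + 1)) := by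
      have hle : ‖(m : ℂ) * φ y₀‖ + 1 ≤ m * Cy + 1 := by
        rw [norm_mul, Complex.norm_natCast]; gcongr; exact hCy φ
      rw [Real.exp_nat_mul, Real.exp_log (by positivity)]
      exact pow_le_pow_left₀ (by positivity) hle _
    have f5 : (max 1 (‖φ α₀ ^ m‖ * Real.exp 1)) ^ T₁ ≤
        Real.exp (T₁ * (m * Real.log Cα + 1)) := by
      have hCα0 : 0 < Cα := by linarith
      have he1 : (1 : ℝ) ≤ Real.exp 1 := by have := Real.add_one_le_exp (1 : ℝ); linarith
      have hle : max 1 (‖φ α₀ ^ m‖ * Real.exp 1) ≤ Real.exp (m * Real.log Cα + 1) := by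
        rw [Real.exp_add, Real.exp_nat_mul, Real.exp_log hCα0]
        refine max_le (one_le_mul_of_one_le_of_one_le (one_le_pow₀ hCα1) he1) ?_
        rw [norm_pow]
        gcongr
        exact hCα φ
      rw [Real.exp_nat_mul]
      exact pow_le_pow_left₀ (by positivity) hle _
    calc (k.factorial : ℝ) * ((((T₀ + 1) * (T₁ + 1) : ℕ) : ℝ) * mvPolyHeight Q *
          (‖(m : ℂ) * φ y₀‖ + 1) ^ T₀ * (max 1 (‖φ α₀ ^ m‖ * Real.exp 1)) ^ T₁)
        ≤ Real.exp (k * Real.log k) * (Real.exp ((T₀ : ℝ) + T₁) *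
          Real.exp (Real.log (max 1 (mvPolyHeight Q : ℝ))) *
          Real.exp (T₀ * Real.log (m * Cy + 1)) * Real.exp (T₁ * (m * Real.log Cα + 1))) := by
          gcongr
      _ = Real.exp A₂ := by rw [hA₂]; simp only [Real.exp_add]; ring
  have hA₂1 : 1 ≤ Real.exp A₂ := by have := Real.add_one_le_exp A₂; linarith
  -- Liouville
  have hL := liouville_lower_bound σ hξ0 hb1 hint hA₂1 hMb
  rw [hconj σ] at hL
  refine le_trans ?_ hL
  have hbR : (((by_ ^ T₀ * (bα ^ m) ^ T₁ : ℕ) : ℝ)) = Real.exp A₁ := by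
    rw [hA₁, Real.exp_add, Real.exp_nat_mul, Real.exp_nat_mul, Real.exp_nat_mul,
      Real.exp_log (by exact_mod_cast hby), Real.exp_log (by exact_mod_cast hbα)]
    push_cast
    ring
  rw [hbR, ← Real.exp_nat_mul, ← Real.exp_nat_mul, ← Real.exp_add, Real.exp_neg]
  refine inv_anti₀ (Real.exp_pos _) (Real.exp_le_exp.mpr ?_)
  have hd1 : (((d - 1 : ℕ) : ℝ)) ≤ d := by exact_mod_cast Nat.sub_le d 1
  nlinarith

end Summit.Schanuel.Schanuel.Theorems

end
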